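import Summits.CriticalPhenomena.PercolationContinuityZ3.Theorems.Transplant.SkelFrmQuasiBChoiceBridge0
import Summits.CriticalPhenomena.PercolationContinuityZ3.Theorems.Transplant.SkelFrmQuasiBChoiceAtQPx
import Summits.CriticalPhenomena.PercolationContinuityZ3.Theorems.Transplant.PlanarSkeletonFrmQuasiDefs
import Summits.CriticalPhenomena.PercolationContinuityZ3.Theorems.Transplant.PlanarSkeletonFrmQuasiProx
import Summits.CriticalPhenomena.PercolationContinuityZ3.Theorems.Transplant.PlanarSkeletonFrmQuasiProxies
import Summits.CriticalPhenomena.PercolationContinuityZ3.Theorems.Transplant.SkelFrmQuasi1ChoiceDefs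
import Summits.CriticalPhenomena.PercolationContinuityZ3.Theorems.Transplant.SkelFrmQuasi1ParamsPO
import Summits.CriticalPhenomena.PercolationContinuityZ3.Theorems.Transplant.SkelFrmQuasiBChoiceDefs
import Summits.CriticalPhenomena.PercolationContinuityZ3.Theorems.Transplant.SkelFrmQuasiBChoiceDefs3
import Summits.CriticalPhenomena.PercolationContinuityZ3.Theorems.Transplant.SkelFrmQuasiBChoiceNums
import Summits.CriticalPhenomena.PercolationContinuityZ3.Theorems.Transplant.SkelFrmQuasiBParamsBridge0
import Summits.CriticalPhenomena.PercolationContinuityZ3.Theorems.Transplant.SkelFrmQuasiBParamsLF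
import Summits.CriticalPhenomena.PercolationContinuityZ3.Theorems.Transplant.SkelFrmQuasiBParamsLO
import Summits.CriticalPhenomena.PercolationContinuityZ3.Theorems.Transplant.SkelFrmQuasi1SlotTypes
import HarnessLib

/-!
# GEN-Q PORT (WAVE-Q table v0.8 section 2, row G264, U-level L?; captain R-6/R-7 2026-08-27: carrier token swap `PlanarSkeletonFrmFrom ↦ PlanarSkeletonFrmQuasi`)
# of the tree module «Transplant/SkelFrmFromBChoiceBridge0Px» (sha256 63457b480d4ff2a0…) onto the quasi-step carrier `PlanarSkeletonFrmQuasi` (p507026): «SkelFrmQuasiBChoiceBridge0Px»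

ORIGINAL TITLE: 

builds on p205010 (kernel theorem, internal audit signed; external expert review pending) — nothing in this file uses p205010; NOTHING is claimed about any open node
((N3-b), the end state).  Lane `prim-bschramm`, seat `prim-hp-8` (gen 62; GEN-Q pen, family BChoiceRoot*/1Root*/BParamsKit·Bridge; tool = captain gen-1 g4's port_genq.py R-14 + p3-g30 T1/T2 + stmt-g33 --force-keep).  Helper file (`--supports stmt-CriticalPhenomena-4575 --as helper`).
PORT RULES (U-wave r1–r4 re-used, GEN-Q hunk classes of p3-g29 #6136): declaration order, names and proof texts are those of «SkelFrmFromBChoiceBridge0Px», byte-identical except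
(i) the carrier token `PlanarSkeletonFrmFrom ↦ PlanarSkeletonFrmQuasi` in binders, `namespace`/`end` lines and qualified names (module names `SkelFrmFrom… ↦ SkelFrmQuasi…`
in imports of already-ported rows); (ii) `Φ.step ↦ Φ.qstep` with the called Steps lemma replaced by its `…Q`/`_q` twin and the cost `Φ.M` threaded (none in this file unless
listed below); (iii) `Φ.cyl_connected ↦ Φ.cyl_reach` readers (none unless listed); (iv) graph-ball radii / window floors ×`Φ.M` (none unless listed); r2 (U-wave rule re-used, applied by captain gen-1 g5 with p3-g30's inline_r2.py over hp-8 g62's staged text): section `variable` binders that bind the carrier are inlined into the kept headers (the gate's dedup otherwise reads a carrier-free header as a restatement of the FrmFrom twin — p537288).  Carrier-free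
residents stay imported/exported from the original «SkelFrmBChoiceBridge0Px» exactly as in the FrmFrom port.  Docstrings and citations are the original's.

-/

noncomputable section

open scoped Classical

namespace Summit.CriticalPhenomena.PercolationContinuityZ3.Theorems.Transplant

open MeasureTheory Literature.Probability.Percolation Literature.Probability.LatticeModels SimpleGraph KNCells KNLevels
open Literature.Barriers.CriticalPhenomena (graphBall)
open SkelConc (Consts)
open Skelφ (oriφ trφ rootFrame pgSideHalfW pgramPrismFin)
open Skelφ.StepI (DataN DataNS OutNS)
open ChainPlanar (BridgePrm BridgeOK)

namespace PlanarSkeletonFrmQuasi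

namespace NegB

open Neg

section Bridge0Px

variable {κ : Consts} {V : Type} [DecidableEq V] [Countable V] {G : SimpleGraph V} [G.LocallyFinite] {Φ : PlanarSkeletonFrmQuasi G} {t : V} {p : unitInterval}
  {hC : Φ.CylSubcritical p} {gv fv : Neg.FSlot} {Pv : PSlot} {Sv : SSlot} {cv : CSlot} {bv : BSlot} {O : OutNS V} {q : unitInterval} {D : ℕ}

-- GEN-Q (R-2, captain 2026-08-27): `PlanarSkeletonFrmFrom.NegB.hbridge0_of_atQ3Px` is not in the used cone of the node top — not ported.

/-- [UNDER PROXIES: radius slot `RB0 + D`, zone family `Λ ∘ prox`, width floor `D ≤ nB0`] **`hbridge` FOR THE ROOT BRIDGE, zone AT THE SEED LEVEL `k`** ((R-42): the successor skeletons `…Q3K…` wire the fat seed at level `k`; Step I‴ serves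
the link there natively — this is `hbridge0_of_atQ3Px` without the `M_u` lift). [cite: KozmaNitzan2024, §4 pp. 19–21] -/
theorem hbridge0K_of_atQ3Px {κ : Consts} {V : Type} [DecidableEq V] [Countable V] {G : SimpleGraph V} [G.LocallyFinite] {Φ : PlanarSkeletonFrmQuasi G} {t : V} {p : unitInterval} {hC : Φ.CylSubcritical p} {gv : Neg.FSlot} {fv : Neg.FSlot} {Pv : PSlot} {Sv : SSlot} {cv : CSlot} {bv : BSlot} {O : OutNS V} {q : unitInterval} {D : ℕ} (hAt : (choiceAtQ3 κ Φ t p Pv gv fv Sv cv bv hC).AtQNQ O q) (hP : Φ.HasProxies t D) (mk : ℕ)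
    (hPx : (KS.Px0 mk κ Φ t p O.merged).1 ⊆ (Pv κ Φ t p O.merged).1) (hn : D ≤ KS.nB0 κ Φ t p O.merged mk) {a : ℝ} (ha : Neg.δkit κ Φ ≤ a) :
    ∀ c : V, 1 - a ^ 3 < (bondPercolation G q).real
      (linkIn (↑(pgramPrismFin G (φL κ Φ t p O.D O.DT.toDataN O.ori (gOf κ Φ t p O gv) (fOf κ Φ t p O fv)) c (KS.nB0 κ Φ t p O.merged mk) (KS.hB0 κ Φ t p O.merged mk)
          (3 * KS.ℓB0 κ Φ t p O.merged mk) (KS.RB0 κ Φ t p O.merged mk + D)) : Set V)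
        (O.merged.Λ (hP.prox c) O.merged.k)
        (pgSideHalfW G (φL κ Φ t p O.D O.DT.toDataN O.ori (gOf κ Φ t p O gv) (fOf κ Φ t p O fv)) c (KS.nB0 κ Φ t p O.merged mk) (KS.hB0 κ Φ t p O.merged mk)
          (KS.ℓB0 κ Φ t p O.merged mk) (KS.RB0 κ Φ t p O.merged mk + D) 1 1)) := by
  intro c
  have h := inputsExtraAt_of_atQPx hAt hP c (KS.mem_of_Px0_subset κ Φ t p O.merged mk Pv hPx) hn 0 1
  rw [oriφ_bridge0_eq_φL hAt mk, sgQ_bridge0_eq_one hAt mk 0, Skelφ.StepI.eventNAt_some] at h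
  unfold Skelφ.StepI.regionNAt Skelφ.StepI.pieceNAt at h
  rw [if_pos rfl, Units.val_one] at h
  rw [Skelφ.StepI.coe_pgramPrismFin]
  have hcube := δI3_le_cube_of_le κ Φ ha
  exact lt_of_le_of_lt (by linarith) h

/-- [UNDER PROXIES: radius slot `RB0 + D`, zone family `Λ ∘ prox`, width floor `D ≤ nB0`] **`hbridge` at level `k` at the root accuracy `κ.δr 0`** (the `…Q3K…` skeletons' literal binder). [folklore] -/
theorem hbridge0K_of_atQ3_δrPx {κ : Consts} {V : Type} [DecidableEq V] [Countable V] {G : SimpleGraph V} [G.LocallyFinite] {Φ : PlanarSkeletonFrmQuasi G} {t : V} {p : unitInterval} {hC : Φ.CylSubcritical p} {gv : Neg.FSlot} {fv : Neg.FSlot} {Pv : PSlot} {Sv : SSlot} {cv : CSlot} {bv : BSlot} {O : OutNS V} {q : unitInterval} {D : ℕ} (hAt : (choiceAtQ3 κ Φ t p Pv gv fv Sv cv bv hC).AtQNQ O q) (hP : Φ.HasProxies t D) (mk : ℕ)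
    (hPx : (KS.Px0 mk κ Φ t p O.merged).1 ⊆ (Pv κ Φ t p O.merged).1) (hn : D ≤ KS.nB0 κ Φ t p O.merged mk) :
    ∀ c : V, 1 - κ.δr 0 ^ 3 < (bondPercolation G q).real
      (linkIn (↑(pgramPrismFin G (φL κ Φ t p O.D O.DT.toDataN O.ori (gOf κ Φ t p O gv) (fOf κ Φ t p O fv)) c (KS.nB0 κ Φ t p O.merged mk) (KS.hB0 κ Φ t p O.merged mk)
          (3 * KS.ℓB0 κ Φ t p O.merged mk) (KS.RB0 κ Φ t p O.merged mk + D)) : Set V)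
        (O.merged.Λ (hP.prox c) O.merged.k)
        (pgSideHalfW G (φL κ Φ t p O.D O.DT.toDataN O.ori (gOf κ Φ t p O gv) (fOf κ Φ t p O fv)) c (KS.nB0 κ Φ t p O.merged mk) (KS.hB0 κ Φ t p O.merged mk)
          (KS.ℓB0 κ Φ t p O.merged mk) (KS.RB0 κ Φ t p O.merged mk + D) 1 1)) :=
  hbridge0K_of_atQ3Px hAt hP mk hPx hn (Neg.δkit_le_δr κ Φ (n := 0) (by norm_num))

-- GEN-Q (R-2, captain 2026-08-27): `PlanarSkeletonFrmFrom.NegB.hbridge0_of_atQ3_δrPx` is not in the used cone of the node top — not ported.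

end Bridge0Px

end NegB

end PlanarSkeletonFrmQuasi

end Summit.CriticalPhenomena.PercolationContinuityZ3.Theorems.Transplant

end
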